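import Summits.QuantumFields.YangMills.Theorems.BalabanUVNodesN12MinimiserFamilyAtRecordBjTowerDatumLettersOnZUniform
import Literature.MathematicalPhysics.QuantumFieldTheory.Balaban1983to89.Node00.MultiScaleFibreChartB
import Summits.QuantumFields.YangMills.Theorems.BalabanUVNodesN12RootedForestLamOfRecord
import Summits.QuantumFields.YangMills.Theorems.BalabanUVNodesN12ClassLetterGeometryOfRecordB
import Summits.QuantumFields.YangMills.Theorems.BalabanUVNodesN12MinimiserFamilyOfClassDatumLettersOnZUniformB
import HarnessLib

/-!
# BalabanUVNodes ∕ N12 — KNIT LINK #2, εreg-UNIFORM DATUM-LETTER-ON-`Z^{(k)}` EDITION: THE w1 LINEAGE’s (J0′) CHART THEOREM AT `𝐁_k(Z)` OVER THE LANE’s U3-onZ — **BOND-DATUM EDITION** (`…N12MinimiserFamilyAtRecordBjTowerDatumLettersOnZUniformB`, USED DECLARATIONS ONLY)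

The print-datum ([Balaban1984PropagatorsII] (2.3)) (γ) twin of `Summits/…/Theorems/BalabanUVNodesN12MinimiserFamilyAtRecordBjTowerDatumLettersOnZUniform.lean`: the declarations of the parent whose STATEMENT reads the determining datum
(`hMin_atRecord_Bj_of_printLetters_ofClassDatumLettersOnZUniform`) and which N12's junction of record v14ᴸ uses (dag-n12-c g35 probe-2 census `UsedConstsN12RoadTyped2`, THEOREMS block), re-typed over a
BOND-LEVEL datum `𝔅 : BDetSet` (F0a `B15DeterminingSetsB`) and dag-n12-c's bond-datum chart `Node00.msChartB` (✓p774329; `msChart 𝐁 = msChartB (bondsDet 𝐁)` by `rfl`).  GENERATOR twin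
(this seat's `work/g32/gen_thm.py`, block-extracted from the parent's tree bytes): namespace `…N12MinimiserFamilyAtRecordBjTowerDatumLettersOnZUniformB`, SAME short names, `DetSet ↦ BDetSet`, `AgreeOn 𝐁 ↦ AgreeOnB 𝔅`,
`IsMinimizer ↦ IsMinimizerB`, `bondsOf (𝐁 j) ↦ 𝔅 j`, `msChart ∕ constrCard ∕ constrEnum ∕ ConstrSet ↦ …B`, NODE 00 chart lemmas `…msChart… ↦ …msChartB…`; proofs VERBATIM; the parent's
datum-free declarations REUSED BY NAME (`open`), never copied (private plumbing excepted, №366 R2).  The parent's (b) statements are the instances `𝔅 := bondsDet 𝐁`.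
THE (J0′) PRODUCER OF RECORD AT PRINT`s [II] (2.3) DATUM (V6u-onZ): over 163 `…DatumLettersOnZUniformB`; the forest + axial slice per instance from the NEW `exists_forest_slice_lamBondsSeq` (dag-n12-w6 g24`s print-rooted forest `N12RootedForestLamOfRecord.exists_rootedForest_lamBondsSeq_maxDomT` + w3`s `exists_forestSlice`); the class letters at `εr` by 124 ✓`classLetters_closure_regMSCoPOfRecord_lamBondsSeq`; `hHB` in (b)-currency VERBATIM; `hMin`-row conclusion over `IsMinimizerB … (lamBondsSeq (maxDomT ν.M₁ Z) k)`.
Cell `pub-ymgap` (HUMAN RULINGS D-0062 ∕ D-0149), seat `pub-ymgap-dag-n12-d` g32 (R134 N12 [B15] s2; the (ii) Theorems-side re-key of N12's road at print's [II] (2.3) datum — director-ym №338 ∕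
№343 (E1)(iii-b), FLAG №16 ∕ ruling (α); dag-n12-c DESIGN memo a793b2ebc0b803bf (ii); `N12-ROAD-TWIN-ORDER-2026-08-30.md`).  Count-neutral helper of K1⁹ `stmt-QuantumFields-27364`,
`--kind proof --supports … --as helper`.  THEOREMS ONLY (0 `def`, 0 `instance`, 0 `sorry`).

HONEST FRAMING (director-ym №338 (5)).  PURELY ADDITIVE: the parent stays landed and true on its own text; nothing in it is edited; no displayed premise of any consumer is deleted or
weakened; every hypothesis of the parent stays a hypothesis.  Nothing of Bałaban's analysis asserted; N12 NOT discharged; K0⁷ ∕ K1⁹ NOT closed; counts unmoved (typed 28∕28 · discharged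
8∕27, A 8∕28; K 1∕4); one finite 𝕋⁴ programme at fixed ε — R4 closes the conditional rung `BalabanLadder.UV` only; NOT the Yang–Mills mass gap (Clay); nothing continuum ∕ ℝ⁴ ∕ OS.

PARENT's DOCSTRING (the mathematics and the citations; read the site-level `𝐁` as the bond datum `𝔅`):
# BalabanUVNodes ∕ N12 — KNIT LINK #2, εreg-UNIFORM DATUM-LETTER-ON-`Z^{(k)}` EDITION: THE w1 LINEAGE’s (J0′) CHART THEOREM AT `𝐁_k(Z)` OVER THE LANE’s U3-onZ
# `N12MinimiserFamilyOfClassDatumLettersOnZUniform` — `δ₀` FIRST, then window ∕ datum tolerance ∕ extension ∕ `K` ∕ `𝓐₀` ∕ class tolerance `εr` ∕ datum bond tolerance `ρn` ∕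
# «T(ρn, εr) ≤ δ₀»; per base field ONLY [15] Thm 1’s rows (E), (T1@q₀) and two DATUM letters on `V_k` — the bond letter now ON THE `k`-BONDS INSIDE `Z^{(k)}` (no region geometry)
# ([Balaban1985Variational] (2)–(4),(7) p. 278, Thm 1 p. 279, (16)–(18) p. 280, Sect. C (44)–(48) p. 285, (81)–(83) p. 290, (181) p. 307; [Balaban1985RegularSpaces] (1.7), (1.9) p. 77,
# (1.19) p. 79; [Balaban1989LargeFieldI] (1.74) p. 192, p. 193, Prop. 1 p. 194; [Balaban1989LargeFieldII] p. 357, (1.12)–(1.13) p. 359; [Balaban1988Convergent] (2.2) p. 255, (2.10)–(2.13)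
# pp. 256–257, (2.16) p. 257; [Balaban1985Averaging] Prop. 2 (52)–(54) p. 26, (122)–(126) p. 36; [Balaban1987RG1] (0.4) p. 253)

Cell `pub-ymgap` (HUMAN RULINGS D-0062 ∕ D-0149), seat `pub-ymgap-dag-n12-d` g25 (R134 N12 [B15] s2 = by-name knit at the record; census item E1 = the (J0′) row); count-neutral helper of K1⁹
`stmt-QuantumFields-27364` (`--kind proof --supports … --as helper`).  THEOREMS ONLY (0 `def`, 0 `instance`, 0 `sorry`); one composition BY NAME + arithmetic, nothing modified.  The onZ
SIBLING of this seat's (C″) `N12MinimiserFamilyAtRecordBjTowerDatumLettersUniform` (g24, p726380, over U3 p725063): SAME composition over the lane's U3-onZ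
`N12MinimiserFamilyOfClassDatumLettersOnZUniform.hMin_atRecord_of_node00Letters_thm1AtBase_central_ofClass_datumLettersOnZ_uniform` (dag-n12-c g27 = U2 §3 ∘ dag-n12-w6 g18's
(σ)_N letter `N12GaugeLetterLocExplicitOnZ.exists_gaugeLetterLoc_atRecord_explicit_onZ`, the cure of w6's ⚑ LOCATED-DATUM-FAR: dag-n12-w3's six region ∕ shadow binders
`𝒞 hD N hGN hN1 hGmem` — whose GLOBAL `hGmem` forced the datum letter onto `k`-bonds arbitrarily far off `Z` — are replaced by ONE datum letter on the `k`-bonds INSIDE `Z^{(k)}`, by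
`N12FarDatumSurgery`: (2.12) minimisers do not read the datum off `Z`).  WHY THE GENERAL-`K` SHAPE ONLY: a per-base-field letter asked of EVERY base field of the closed guard is never
dischargeable (the lane's ⚑ LOCATED-GAUGE-ORBIT: the guard is gauge invariant, datum letters are not); the consumer (`N12MinimiserFamilyKnitRowThm1LettersOnZ`) feeds THIS theorem on the
COMPACT normalised slice and returns along the gauge orbit.  DISCHARGED here, as in (C″): the forest BEFORE `δ₀` (dag-n12-w3 `exists_forest_slice_Bj`); UNDER `∀ εr`, the class facts
at `ν⟨εreg := εr⟩` (dag-n12-w1 g4 `classLetters_closure_regMSCoPOfRecord_Bj`) AND U3-onZ's (σ)_N class numerics `hα3`∕`hα2`∕`haN` at `α₀ = εr·L²` (from `hα3`∕`hα2` at `2L²·εr`).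
DISPLAYED VERBATIM from U3-onZ: instance-level the (σ)_N level guard `hkc` ∕ no-wrap `hc` ∕ radii `hMrad` ∕ support `hM₁` numerics; per height `hsbU` at `ρ″ > 0`, `hHB`, `0 ≤ B`;
after `δ₀`: window, datum tolerance + budget, extension, `K`, `𝓐₀`, `εr > 0` + floors + `hα3 hα2`, `ρn ≥ 0`, «T ≤ δ₀».  Per base field EXACTLY: (E) `IsMinimizer` for
`U_k({Ω_j(Z)}, εr)`; `PlaqSmallOn (plaqsInside (pts k Z)) δ (ext V_k)`; `∀ e, e.src ∈ pts k Z → e.tgt ∈ pts k Z → dist1 ((ext V_k) e) ≤ ρn`; (T1@q₀) over the closure of the class.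

HONEST FRAMING ∕ LOCATED.  Composition by name + arithmetic; (E)∕(T1@q₀) are [15] Thm 1's existence ∕ uniqueness rows (NODE 00 ∕ N07 ∕ b11 currencies; the lane's
`B15Prop1Thm1RowsOfExistsUnique` reduces them to two closed letters downstream) — NOT inhabited here; the onZ datum letter is a gauge condition on the BASE FIELD (print's p. 194 orbit
reduction), removed downstream along the orbit at BOX scope only; `δ₀` and `R` are EXISTENCE constants per (instance, height) (census U4; print's volume-uniform (46)∕(83) and
`k`-uniformity NOT claimed); nothing of Bałaban's estimates asserted; N12 NOT discharged; K1⁹ NOT closed; counts unmoved; one finite 𝕋⁴ programme at fixed `ε = L^{-K}` — R4 closes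
the conditional rung `BalabanLadder.UV` only; no summit statement is proved here and NOT the Yang–Mills mass gap (Clay); nothing continuum ∕ ℝ⁴ ∕ OS.
-/

noncomputable section

namespace Summit.QuantumFields.YangMills.BalabanUVNodes.N12MinimiserFamilyAtRecordBjTowerDatumLettersOnZUniformB

open Literature.MathematicalPhysics.QuantumFieldTheory.Balaban1983to89.B15DeterminingSetsB

open scoped BigOperators Matrix.Norms.L2Operator Topology
open Literature.MathematicalPhysics.QuantumFieldTheory.Balaban1983to89
open T4Continuum
open B15DeterminingSets GaugeField
open ExpMeanLog (expMeanLogSU deltaSU deltaSU_pos)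
open T4AdjointCovarianceUnitary (lieSU)
open Node00 hiding blockIter
open B15SU2ChartHolomorphic (genE)
open B15Prop1AnalyticExtClause (cplxVec)
open B15Prop1ChartCalculusSU2 (E3)
open T4CubeChartGnomonic (SU2)
open B14.Eq213DetSet (Bj maxDomT Bj_of_gt)
open B14.Eq213MaximalDomains (side)
open B14.Eq22Determines (IsBlockUnion blockIter)
open B14.Eq216Concrete (feeds)
open B5Eq118OneStroke (iterBlockOf)
open B15Eq112TorusCover (lift)
open T4AxialGaugeSmallField (boxPlaqs)
open B15Prop1Carrier (plaqsInside)
open Summit.QuantumFields.YangMills.BalabanUVNodes.N12ClassLetterGeometryOfRecordB (classLetters_closure_regMSCoPOfRecord_lamBondsSeq)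
open Summit.QuantumFields.YangMills.BalabanUVNodes.N12MinimiserFamilyOfClassDatumLettersOnZUniformB (hMin_atRecord_of_node00Letters_thm1AtBase_central_ofClass_datumLettersOnZ_uniform)
open Literature.MathematicalPhysics.QuantumFieldTheory.BalabanImbrieJaffe1984to88.BIJ85Eq453GaugeField (qsstarGIter0)
open B15AveragingHolomorphic (iterMh)
open B15SU2ChartHolomorphic (expMulC logCoordC)
open B15ShellGauge193 (shellGauge)
open B15Extension193 (extend)
open B16Sect1Backgrounds (toMS expMul)
open B15Prop1ChartSU2 (su2Chart)
open Metric (ball)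
open B15Prop1ClosedGuardUniformRadius (isCompact_setOf_plaqLeOn)
open Node00 (msChart constrCard constrEnum)

section PrintForestSlice

open B15ComplexifiedDatumFamily (conjVec)
open Summit.QuantumFields.YangMills.BalabanUVNodes.N12ForestSlice (exists_forestSlice)
open Summit.QuantumFields.YangMills.BalabanUVNodes.N12RootedForestLamOfRecord (exists_rootedForest_lamBondsSeq_maxDomT)

variable {P : Params}

/-- **ONE FOREST AND ITS AXIAL SLICE AT PRINT's [II] (2.3) DATUM** — `N12ForestSlice.exists_forest_slice_Bj` with (F2)∕(TREE) on the PRINT root set `{ι_j c± : c ∈ lamBondsSeq (maxDomT M₁ Z) k j, j ≤ k}`: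
dag-n12-w6 g24's print-rooted forest `N12RootedForestLamOfRecord.exists_rootedForest_lamBondsSeq_maxDomT` ((F1), (F2), (TREE)) + w3's root-set-free axial slice `exists_forestSlice` ((F3), conjugation).
[cite: Balaban1984PropagatorsII, (2.3) p.224; Balaban1985Variational, Sect. C (44)–(48) p.285, (82)–(83) p.290; Balaban1988Convergent, (2.2) p.255, (2.10)–(2.13) pp.256–257] -/
theorem exists_forest_slice_lamBondsSeq {k M₁ : ℕ} {Z : Set (Site P 0)} (hk : k ≤ P.m + P.K) (hk1 : 1 ≤ k) (hM : 1 ≤ M₁) (hdiv : side P.L M₁ k ∣ P.sitesPerDir 0) :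
    ∃ (path : Site P 0 → List (LStep P 0)) (S : Submodule ℂ (VecField P 0 (EuclideanSpace ℂ (Fin 3)))),
      (∀ x, ∀ s ∈ path x, ∃ x' x'' : Site P 0, path x'' = path x' ++ [s] ∧
        (s.fwd = true → s.bond.src = x' ∧ s.bond.tgt = x'') ∧ (s.fwd = false → s.bond.src = x'' ∧ s.bond.tgt = x')) ∧
      (∀ j, j ≤ k → ∀ c ∈ lamBondsSeq (maxDomT M₁ Z) k j, path (embIter j c.src) = [] ∧ path (embIter j c.tgt) = []) ∧
      (∀ x : Site P 0, x ∉ {z : Site P 0 | ∃ j, j ≤ k ∧ ∃ c ∈ lamBondsSeq (maxDomT M₁ Z) k j, (z = embIter j c.src ∨ z = embIter j c.tgt)} →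
        ∃ (x' : Site P 0) (s : LStep P 0), path x = path x' ++ [s] ∧
          (s.fwd = true → s.bond.src = x' ∧ s.bond.tgt = x) ∧ (s.fwd = false → s.bond.src = x ∧ s.bond.tgt = x')) ∧
      (∀ X, X ∈ S ↔ ∀ x, ∀ s ∈ path x, X s.bond = 0) ∧ (∀ X ∈ S, conjVec X ∈ S) := by
  obtain ⟨path, h1, h2, h3⟩ := exists_rootedForest_lamBondsSeq_maxDomT (Z := Z) hk hk1 hM hdiv
  obtain ⟨S, hS, hconj⟩ := exists_forestSlice path
  exact ⟨path, S, h1, h2, h3, hS, hconj⟩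

end PrintForestSlice

section
variable {F : T4Family} {k : ℕ}

/-- ★★★ **KNIT LINK #2, εreg-UNIFORM, DATUM LETTER ON `Z^{(k)}`** — the lineage's (J0′) `hMin` conclusion for the unions of cubes `Ω_j(Z)`, `𝔅 := 𝐁_k(Z)` (`IsBlockUnion k Z`), from
the per-height letters (`hsbU` at `ρ″ > 0`, `hHB` at `(εH, B)`) and U3-onZ's (σ)_N numerics (`hkc hc hMrad hM₁`) — the forest is discharged; ANNOUNCED `∃ δ₀ > 0`; THEN for every window
`Λ lo hi`, datum tolerance `δ > 0` within the budget `6(d−1)Lᵏ·δ ≤ ρ″`, extension `ext`, compact `K`, bound `𝓐₀ > 1`, class tolerance `εr > 0` below the floors with [4] Prop. 2's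
smallness (`hα3`, `hα2` — class facts and U3's class numerics discharged), datum bond tolerance `ρn ≥ 0` with «`T(ρn, εr) ≤ δ₀`»: per base field `V_k ∈ K` ONLY (E) `IsMinimizer`,
`PlaqSmallOn (plaqsInside (pts k Z)) δ (ext V_k)`, `∀ e, e.src ∈ pts k Z → e.tgt ∈ pts k Z → dist1 ((ext V_k) e) ≤ ρn`, (T1@q₀) over the closure of the class ⟹ [IV] Prop. 1's
`R > 0` and the holomorphic bounded family of minimisers on `K`.
[cite: Balaban1985Variational, (2),(7) p.278, Thm 1 p.279, (16)–(18) p.280, Sect. C (44)–(48) p.285, (81)–(83) p.290, (181) p.307; Balaban1985RegularSpaces, (1.7), (1.9) p.77, (1.19) p.79; Balaban1989LargeFieldI, (1.74) p.192, p.193 L14–20, Prop. 1 p.194; Balaban1989LargeFieldII, p.357, (1.12)–(1.13) p.359; Balaban1988Convergent, (2.2) p.255, (2.10)–(2.13) pp.256–257, (2.16) p.257; Balaban1985Averaging, Prop. 2 (52)–(54) p.26, (122)–(126) p.36; Balaban1987RG1, (0.4) p.253] -/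
theorem hMin_atRecord_lamBondsSeq_of_printLetters_ofClassDatumLettersOnZUniform (ν : Node00.Stage7Numerics) (Kt : ℕ) (hd3 : 3 ≤ (F.P Kt).d) (Z : Set (Site (F.P Kt) 0))
    (hkK : k + 1 ≤ (F.P Kt).m + (F.P Kt).K) (hk1 : 1 ≤ k) (hdiv : side (F.P Kt).L ν.M₁ k ∣ (F.P Kt).sitesPerDir 0) (hfloor : ((F.P Kt).d + 14) * (F.P Kt).L ≤ ν.M₁) (hZblk : IsBlockUnion k Z)
    -- the per-HEIGHT letters (EXISTENCE constants per (instance, height), inhabited before everything else by dag-n12-w6's `N12HsurjOfClass.exists_hsurjLetters`): the radius letter `hsbU` at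
    -- `ρ″ > 0` and the right-inverse letter `hHB` at `(εH, B)`, `0 ≤ B` — `ν.εreg` is NOT read (the class tolerance `εr` comes after the threshold)
    {ρ'' : ℝ} (hsbU : ∀ W : GaugeField (F.P Kt) 0 SU2, ‖coeField W - 1‖ ≤ ρ'' → SmallBelow (Node00.avOfRecord F 2 Kt) k W) (hρ : 0 < ρ'')
    {εH B : ℝ}
    (hHB : ∀ (Wd : MSField (F.P Kt) SU2) (U₀ : GaugeField (F.P Kt) 0 SU2),
      AgreeOn (Bj ν.M₁ Z k) (avgFamily (avOfRecord F 2 Kt) U₀) Wd →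
      (∀ i' : Fin (constrCard (Bj ν.M₁ Z k) k), ∃ U' : GaugeField (F.P Kt) 0 SU2,
        (∀ b ∈ feeds (((constrEnum (Bj ν.M₁ Z k) k).symm i').1 : ℕ) ((constrEnum (Bj ν.M₁ Z k) k).symm i').2.1, U' b = U₀ b) ∧
          SmallBelow (avOfRecord F 2 Kt) k U') →
      (∀ (j : ℕ), 1 ≤ j → j ≤ k → ∀ y : Site (F.P Kt) j, embIter j y ∈ maxDomT ν.M₁ Z j → ∃ U' : GaugeField (F.P Kt) 0 SU2,
        (∀ c : PBond (F.P Kt) j, (c.src = y ∨ c.tgt = y) → ∀ b₀ : PBond (F.P Kt) 0,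
          (iterBlockOf j b₀.src = c.src ∨ iterBlockOf j b₀.src = c.tgt) → (iterBlockOf j b₀.tgt = c.src ∨ iterBlockOf j b₀.tgt = c.tgt) → U' b₀ = U₀ b₀) ∧
        SmallBelow (avOfRecord F 2 Kt) k U') →
      (∀ (j : ℕ), 1 ≤ j → j ≤ k → ∀ y : Site (F.P Kt) j, embIter j y ∈ maxDomT ν.M₁ Z j →
        PlaqSmallOn (boxPlaqs (fun κ => lift (F.P Kt) (embIter j y) κ - ((((F.P Kt).L ^ j : ℕ) : ℤ) + ((((F.P Kt).L ^ j - 1) / 2 : ℕ) : ℤ)))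
          (fun κ => lift (F.P Kt) (embIter j y) κ + ((((F.P Kt).L ^ j : ℕ) : ℤ) + ((((F.P Kt).L ^ j - 1) / 2 : ℕ) : ℤ))) : Set (Plaq (F.P Kt) 0)) εH U₀) →
      ∃ H : (Fin (constrCard (Bj ν.M₁ Z k) k) → lieSU (Fin 2)) → PBond (F.P Kt) 0 → lieSU (Fin 2),
        (∀ v, fderiv ℝ (msChart F 2 Kt k (Bj ν.M₁ Z k) Wd U₀) 0 (H v) = v) ∧ ∀ v, Real.sqrt (∑ b, ‖H v b‖ ^ 2) ≤ B * ‖v‖) (hB0 : 0 ≤ B)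
    -- (σ)_N OF RECORD, onZ EDITION (dag-n12-w6 g18's `N12GaugeLetterLocExplicitOnZLam.exists_gaugeLetterLoc_atRecord_lamBondsSeq_explicit_onZ` inside the lane's U3-onZ), instance-level NUMERICS verbatim:
    -- NUMERICS (i): a level guard `k + c ≤ m + K` with `4d + m′ + 3 < 2·L^c` (no wrapping), and `M₁ ≥ (4d + m′)·L² + 2d·L + 12` (radii), `m′ = 3·(d·((L−1)∕2)) + 5`
    {c : ℕ} (hkc : k + c ≤ (F.P Kt).m + (F.P Kt).K) (hc : 4 * (F.P Kt).d + (3 * ((F.P Kt).d * (((F.P Kt).L - 1) / 2)) + 5) + 3 < 2 * (F.P Kt).L ^ c)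
    (hMrad : (4 * (F.P Kt).d + (3 * ((F.P Kt).d * (((F.P Kt).L - 1) / 2)) + 5)) * (F.P Kt).L ^ 2 + 2 * (F.P Kt).d * (F.P Kt).L + 12 ≤ ν.M₁)
    -- the family's support numerics: `M₁ ≥ ((d+4)L + 6)·L²`
    (hM₁ : (((F.P Kt).d + 4) * (F.P Kt).L + 6) * (F.P Kt).L ^ 2 ≤ ν.M₁) :
    ∃ δ₀ : ℝ, 0 < δ₀ ∧
    -- THE WINDOW, THE DATUM's REGULARITY TOLERANCE, THE EXTENSION, THE COMPACT PARAMETER SET AND THE BOUND — ALL AFTER THE CONSTANTS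
    ∀ (Λ : Set (Site (F.P Kt) k)) (lo hi : Fin (F.P Kt).d → ℤ) {δ : ℝ}, 0 < δ → 6 * ((((F.P Kt).d - 1 : ℕ)) : ℝ) * (F.P Kt).L ^ k * δ ≤ ρ'' →
    ∀ (ext : GaugeField (F.P Kt) k SU2 → GaugeField (F.P Kt) k SU2), (∀ W, ext W = extend Λ (shellGauge W lo hi) W) →
    ∀ {K : Set (GaugeField (F.P Kt) k SU2)}, IsCompact K → ∀ {𝓐₀ : ℝ}, 1 < 𝓐₀ →
    -- THE CLASS TOLERANCE (positive, [4]-Prop.-2-small, below the floors), THE CLASS FACTS, THE DATUM TOLERANCE — ALL AFTER THE THRESHOLD (`ν⟨εreg := εr⟩`, `M₁` unchanged)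
    -- (w1 g4's class letters at the tolerance `εr`: positivity and [4] Prop. 2's smallness at `α₀ = 2L²·εr` — the inputs of `classLetters_closure_regMSCoPOfRecord_lamBondsSeq`, which discharges U3's
    -- class facts `reg' hreg' hcl hDreg'` at `reg' := closure` of `U_k({Ω_j(Z)}, εr)`; U3's own (σ)_N class numerics `hα3`∕`hα2`∕`haN` at `α₀ = εr·L²` follow from them and are discharged)
    ∀ (εr : ℝ), 0 < εr → 12 * ((((F.P Kt).d - 1 : ℕ)) : ℝ) * (F.P Kt).L * εr ≤ ρ'' → εr ≤ εH →
      (143 * (((((F.P Kt).d + 4 : ℕ) : ℝ)) ^ 2 / 4) ^ 2) * (2 * ((F.P Kt).L : ℝ) ^ 2 * εr) ≤ 1 / 3 →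
      2 * (2 * ((F.P Kt).L : ℝ) ^ 2 * εr) ≤ 2 * deltaSU (Fin 2) / ((((F.P Kt).d + 4) * (F.P Kt).L : ℕ) : ℝ) ^ 2 →
    ∀ {ρn : ℝ}, 0 ≤ ρn →
    ((max ρn ((((2 * (∑ i ∈ Finset.range (k + 1), ((F.P Kt).d * (((F.P Kt).L ^ i - 1) / 2) + 1)) + 1 +
                  (3 * ((F.P Kt).d * (((F.P Kt).L - 1) / 2)) + 5) * (F.P Kt).L ^ k : ℕ) : ℝ)) ^ 2 / 4 * (εr * (F.P Kt).eta 0 ^ 2) +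
                ((3 * ((F.P Kt).d * (((F.P Kt).L - 1) / 2)) + 5 : ℕ) : ℝ) * (6 * ((((((F.P Kt).d + 2) * (F.P Kt).L : ℕ) : ℝ) ^ 2 / 4) * (2 * (εr * (F.P Kt).L ^ 2))) * ∑ i ∈ Finset.range k, ((F.P Kt).L : ℝ) ^ i) + ((3 * ((F.P Kt).d * (((F.P Kt).L - 1) / 2)) + 5 : ℕ) : ℝ) * ρn) ≤ δ₀) →
    (∀ Vk ∈ K, ∃ U₀ : GaugeField (F.P Kt) 0 SU2,
      IsMinimizerB (Node00.avOfRecord F 2 Kt) (Node00.regMSCoPOfRecord F 2 {ν with εreg := εr} Kt k (maxDomT ν.M₁ Z)) (lamBondsSeq (maxDomT ν.M₁ Z) k)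
        (avgFamily (Node00.avOfRecord F 2 Kt) (qsstarGIter0 k (ext Vk))) U₀ ∧
      -- the DATUM's scale-`k` plaquette regularity on `Z` (the p. 193 extension `Ṽ_k = ext V_k`; the road's `B15ShellGauge193Local.dist1_plaqHol_extend_shellGauge_le`)
      PlaqSmallOn (plaqsInside (pts k Z)) δ (ext Vk) ∧
      -- THE DATUM LETTER ON `Z^{(k)}` (dag-n12-w6 g18's onZ producer): `ext V_k` is `ρn`-flat on the `k`-bonds INSIDE `Z^{(k)}`
      (∀ e : PBond (F.P Kt) k, e.src ∈ pts k Z → e.tgt ∈ pts k Z → dist1 ((ext Vk) e) ≤ ρn) ∧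
      -- (T1@q₀) — the capstone's row verbatim
      (∀ U ∈ closure (Node00.regMSCoPOfRecord F 2 {ν with εreg := εr} Kt k (maxDomT ν.M₁ Z)),
        AgreeOnB (lamBondsSeq (maxDomT ν.M₁ Z) k) (avgFamily (Node00.avOfRecord F 2 Kt) U) (avgFamily (Node00.avOfRecord F 2 Kt) (qsstarGIter0 k (ext Vk))) →
        wilsonAction4 U ≤ wilsonAction4 U₀ →
          ∃ u : GaugeTransf (F.P Kt) 0 SU2, (∀ j, j ≤ k → ∀ b ∈ lamBondsSeq (maxDomT ν.M₁ Z) k j, toMS u j b.src = toMS u j b.tgt ∧ ∀ g : SU2, toMS u j b.src * g = g * toMS u j b.src) ∧ gaugeAct u U = U₀)) →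
    ∃ R : ℝ, 0 < R ∧ ∀ Vk ∈ K,
      ∃ Ũ : VecField (F.P Kt) k (EuclideanSpace ℂ (Fin 3)) × VecField (F.P Kt) k (EuclideanSpace ℂ (Fin 3)) → PBond (F.P Kt) 0 → Matrix (Fin 2) (Fin 2) ℂ,
        (∀ b i j, DifferentiableOn ℂ (fun z => Ũ z b i j) (ball 0 R)) ∧
        (∀ z ∈ ball (0 : VecField (F.P Kt) k (EuclideanSpace ℂ (Fin 3)) × VecField (F.P Kt) k (EuclideanSpace ℂ (Fin 3))) R, ∀ b i j, ‖Ũ z b i j‖ ≤ 𝓐₀) ∧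
        ∀ p B' : VecField (F.P Kt) k E3, ‖p‖ < R → ‖B'‖ < R → ∃ U' : GaugeField (F.P Kt) 0 SU2,
          (∀ b, Ũ (cplxVec p, cplxVec B') b = ((U' b : SU2) : Matrix (Fin 2) (Fin 2) ℂ)) ∧
            IsMinimizerB (Node00.avOfRecord F 2 Kt) (Node00.regMSCoPOfRecord F 2 {ν with εreg := εr} Kt k (maxDomT ν.M₁ Z)) (lamBondsSeq (maxDomT ν.M₁ Z) k)
              (avgFamily (Node00.avOfRecord F 2 Kt) (qsstarGIter0 k (expMul su2Chart B' (ext (expMul su2Chart p Vk))))) U') := by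
  have hk : k ≤ (F.P Kt).m + (F.P Kt).K := Nat.le_of_succ_le hkK
  have hM4 : 4 * (F.P Kt).L ≤ ν.M₁ := le_trans (Nat.mul_le_mul_right _ (by omega)) hfloor
  have hM : 1 ≤ ν.M₁ := le_trans (Nat.succ_le_of_lt (Nat.mul_pos (Nat.succ_pos _) (F.P Kt).L_pos)) hfloor
  have hd2 : 2 ≤ (F.P Kt).d := le_trans (by norm_num) hd3
  -- ONE forest with its axial slice (dag-n12-w3), BEFORE the threshold
  obtain ⟨path, S, hF1, hF2, hTREE, hF3, -⟩ := exists_forest_slice_lamBondsSeq (P := F.P Kt) (M₁ := ν.M₁) (Z := Z) hk hk1 hM hdiv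
  obtain ⟨δ₀, hδ₀, h⟩ := hMin_atRecord_of_node00Letters_thm1AtBase_central_ofClass_datumLettersOnZ_uniform ν Kt hd2 Z (lamBondsSeq (maxDomT ν.M₁ Z) k) rfl hkK hM4 hdiv hZblk hsbU hρ hk1 hHB hB0 path S hF1 hF2 hTREE hF3
    hkc hc hMrad hM₁
  refine ⟨δ₀, hδ₀, ?_⟩
  intro Λ lo hi δ hδ hδρ ext hext K hK 𝓐₀ h𝓐₀ εr hεr hερ hεH hα3 hα2 ρn hρn hT hbase
  -- U3's (σ)_N class numerics at `α₀ = εr·L²` from the class letters at `α₀ = 2L²·εr`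
  have hL : (0 : ℝ) < ((F.P Kt).L : ℝ) := by exact_mod_cast (F.P Kt).L_pos
  have hEL : 0 ≤ εr * ((F.P Kt).L : ℝ) ^ 2 := by positivity
  have hE2 : εr * ((F.P Kt).L : ℝ) ^ 2 ≤ 2 * ((F.P Kt).L : ℝ) ^ 2 * εr := by nlinarith [hEL]
  have hα3' : (143 * (((((F.P Kt).d + 4 : ℕ) : ℝ)) ^ 2 / 4) ^ 2) * (εr * (F.P Kt).L ^ 2) ≤ 1 / 3 :=
    le_trans (mul_le_mul_of_nonneg_left hE2 (by positivity)) hα3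
  have hα2' : 2 * (εr * (F.P Kt).L ^ 2) ≤ 2 * deltaSU (Fin 2) / ((((F.P Kt).d + 4) * (F.P Kt).L : ℕ) : ℝ) ^ 2 := le_trans (by linarith) hα2
  have haN : (((((F.P Kt).d + 2) * (F.P Kt).L : ℕ) : ℝ) ^ 2 / 4) * (2 * (εr * (F.P Kt).L ^ 2)) < deltaSU (Fin 2) := by
    have h24 : ((((F.P Kt).d + 2) * (F.P Kt).L : ℕ) : ℝ) ≤ ((((F.P Kt).d + 4) * (F.P Kt).L : ℕ) : ℝ) := by
      exact_mod_cast Nat.mul_le_mul_right _ (by omega)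
    have hsq : ((((F.P Kt).d + 2) * (F.P Kt).L : ℕ) : ℝ) ^ 2 ≤ ((((F.P Kt).d + 4) * (F.P Kt).L : ℕ) : ℝ) ^ 2 := by gcongr
    have hδS : 0 < deltaSU (Fin 2) := deltaSU_pos
    have hD4 : (0 : ℝ) < ((((F.P Kt).d + 4) * (F.P Kt).L : ℕ) : ℝ) := by exact_mod_cast Nat.mul_pos (by omega) (F.P Kt).L_pos
    have h1 : 2 * (2 * ((F.P Kt).L : ℝ) ^ 2 * εr) * ((((F.P Kt).d + 4) * (F.P Kt).L : ℕ) : ℝ) ^ 2 ≤ 2 * deltaSU (Fin 2) :=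
      (le_div_iff₀ (by positivity)).1 hα2
    have h2 : εr * (F.P Kt).L ^ 2 * ((((F.P Kt).d + 4) * (F.P Kt).L : ℕ) : ℝ) ^ 2 ≤ deltaSU (Fin 2) / 2 := by nlinarith [h1]
    have h3 : εr * (F.P Kt).L ^ 2 * ((((F.P Kt).d + 2) * (F.P Kt).L : ℕ) : ℝ) ^ 2 ≤ deltaSU (Fin 2) / 2 :=
      le_trans (mul_le_mul_of_nonneg_left hsq hEL) h2
    nlinarith [h3, hδS]
  -- the class facts (dag-n12-w1 g4) at the tolerance `εr`
  obtain ⟨hreg', hcl, hDreg'⟩ :=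
    classLetters_closure_regMSCoPOfRecord_lamBondsSeq (F := F) (N := 2) (K := Kt) {ν with εreg := εr} hεr hk hdiv hfloor Z k (Nat.le_succ k) hα3 hα2
  exact h Λ lo hi hδ hδρ ext hext hK h𝓐₀ εr hεr hερ hεH hα3' hα2' haN (closure (Node00.regMSCoPOfRecord F 2 {ν with εreg := εr} Kt k (maxDomT ν.M₁ Z))) hreg' hcl hDreg' hρn hT hbase

end

end Summit.QuantumFields.YangMills.BalabanUVNodes.N12MinimiserFamilyAtRecordBjTowerDatumLettersOnZUniformB

end
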